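import Mathlib
import HarnessLib
import Summits.HubbardSuperconductivity.HubbardSuperconductivity.Theorems.KLProgrammeKLRegimeBetaSplitFreezing
import Summits.HubbardSuperconductivity.HubbardSuperconductivity.Theorems.KLProgrammeKLRegimeSplitDefs

/-!
# Route `KLProgramme`, crux K3 (stmt-HubbardSuperconductivity-19937), child 1 `KLRegimeBetaSplit` — companion to
# `KLProgrammeKLRegimeBetaSplitFreezing`: the VALUE-level telescope and the two additive per-scale terms of (E2′-v3)
# (thermal layer, leg dressing) summed over the scales

Cell gate-hubbard-kl, seat p1b (g3).  Text: HOME/STATUS 2026-08-26T12:02Z (p1b NOD on V3-R), HOME/prover-p1b/GAINS-NOTE.md §5.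

* `klbf_norm_sub_le_sum_Ioc` — `‖f N - f t‖ ≤ Σ_{n ∈ (t, N]} ‖f n - f (n-1)‖` in any normed group: how the pointwise quartic
  VALUES (V3-R's `klQuarticValue`, `klPairAmplitude`) telescope; combined with `klbf_sum_le_of_perScale` it is the whole
  «frozen values» bookkeeping of row 0′ / the value line.
* `klbf_sum_thermal_le` — the THERMAL-LAYER term `(4^(n_β - n))⁻¹` (ℕ-subtraction) of (E2′-v3) sums over any set of scales
  `n ≤ n_β` to `≤ 4/3` (Lemma E.2 (iii): the last two scales' zero-transfer slice bubble is O(1), placed by `β`, hence not a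
  `G`-profile).
* `klbf_card_legSlice_le` — a leg's band energy `e` lies in the window `Λ_{n+2} ≤ e ≤ Λ_{n-2}` (`Λ_n = klScale e₀ n`) for at most
  `5` scales `n`: the LEG-DRESSING term of (E2′-v3) (one-particle-reducible dressing of an external leg of the connected-amputated
  Wilsonian carrier changes only when the leg crosses the slice) sums to `≤ 5` per leg, `≤ 20` per 4-tuple of legs.

Pure bookkeeping; nothing is asserted about the model.
-/

noncomputable section

namespace Summit.HubbardSuperconductivity.HubbardSuperconductivity.Theorems.KLRegimeSplit

set_option linter.dupNamespace false -- summit = problem name (single-conjunct summit), D-0017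

open Real Finset
open Summit.HubbardSuperconductivity.HubbardSuperconductivity.Theorems.KLProgrammeLegKernels

/-! ## §1 Values telescope -/

/-- **Value-level telescope**: `‖f N - f t‖ ≤ Σ_{n ∈ Ioc t N} ‖f n - f (n-1)‖` (`t ≤ N`), in any seminormed group. -/
theorem klbf_norm_sub_le_sum_Ioc {E : Type*} [SeminormedAddCommGroup E] (f : ℕ → E) {t N : ℕ} (h : t ≤ N) :
    ‖f N - f t‖ ≤ ∑ n ∈ Ioc t N, ‖f n - f (n - 1)‖ := by
  rw [← klbf_sum_Ioc_sub_telescope f h]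
  exact norm_sum_le _ _

/-- **Frozen values**: per-scale value increments `‖f n - f (n-1)‖ ≤ a·(g₁ n + g₂ n + g₃ n) + e n` on `(t, N]` with the gain sums
and the remainder sum bounded give `‖f N - f t‖ ≤ a·(C₁ + C₂ + C₃) + E`. -/
theorem klbf_norm_sub_le_of_perScale {E : Type*} [SeminormedAddCommGroup E] (f : ℕ → E) {t N : ℕ} (h : t ≤ N)
    {g₁ g₂ g₃ e : ℕ → ℝ} {a C₁ C₂ C₃ Etot : ℝ} (ha : 0 ≤ a)
    (hincr : ∀ n ∈ Ioc t N, ‖f n - f (n - 1)‖ ≤ a * (g₁ n + g₂ n + g₃ n) + e n)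
    (h₁ : ∑ n ∈ Ioc t N, g₁ n ≤ C₁) (h₂ : ∑ n ∈ Ioc t N, g₂ n ≤ C₂) (h₃ : ∑ n ∈ Ioc t N, g₃ n ≤ C₃)
    (hE : ∑ n ∈ Ioc t N, e n ≤ Etot) :
    ‖f N - f t‖ ≤ a * (C₁ + C₂ + C₃) + Etot :=
  (klbf_norm_sub_le_sum_Ioc f h).trans (klbf_sum_le_of_perScale ha hincr h₁ h₂ h₃ hE)

/-! ## §2 The thermal-layer term -/

/-- The thermal-layer weight `(4^(M - n))⁻¹` summed over any finite set of scales `n ≤ M` is `≤ 4/3`. -/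
theorem klbf_sum_thermal_le (M : ℕ) (s : Finset ℕ) (hs : ∀ n ∈ s, n ≤ M) :
    ∑ n ∈ s, ((4 : ℝ) ^ (M - n))⁻¹ ≤ 4 / 3 := by
  classical
  -- reindex by `k = M - n`, injective on `{n ≤ M}`
  have hinj : Set.InjOn (fun n => M - n) (s : Set ℕ) := by
    intro a ha b hb hab
    have ha' := hs a ha; have hb' := hs b hb
    simp only at hab; omega
  calc ∑ n ∈ s, ((4 : ℝ) ^ (M - n))⁻¹ = ∑ k ∈ s.image (fun n => M - n), ((4 : ℝ) ^ k)⁻¹ := by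
        rw [sum_image hinj]
    _ ≤ ∑ k ∈ range (M + 1), ((4 : ℝ) ^ k)⁻¹ := by
        refine sum_le_sum_of_subset_of_nonneg (fun k hk => ?_) fun k _ _ => by positivity
        obtain ⟨n, hn, rfl⟩ := mem_image.mp hk
        exact mem_range.mpr (by have := hs n hn; omega)
    _ ≤ 4 / 3 := by
        have h : ∑ k ∈ range (M + 1), ((4 : ℝ) ^ k)⁻¹ = ∑ k ∈ range (M + 1), (1 / 4 : ℝ) ^ k :=
          sum_congr rfl fun k _ => by rw [one_div, inv_pow]
        rw [h, ← Nat.Ico_zero_eq_range]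
        calc ∑ k ∈ Ico 0 (M + 1), (1 / 4 : ℝ) ^ k ≤ (1 / 4 : ℝ) ^ 0 / (1 - 1 / 4) :=
              geom_sum_Ico_le_of_lt_one (by norm_num) (by norm_num)
          _ = 4 / 3 := by norm_num

/-- The thermal-layer term of (E2′-v3) summed over the scales of the analysis: for `N ≤ n_β`,
`Σ_{n ∈ Ioc t N} C·(4^(n_β - n))⁻¹ ≤ (4/3)·C` (`C ≥ 0`). -/
theorem klbf_sum_Ioc_thermal_le {C : ℝ} (hC : 0 ≤ C) {t N nβ : ℕ} (hN : N ≤ nβ) :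
    ∑ n ∈ Ioc t N, C * ((4 : ℝ) ^ (nβ - n))⁻¹ ≤ 4 / 3 * C := by
  rw [← mul_sum]
  have h := klbf_sum_thermal_le nβ (Ioc t N) fun n hn => ((mem_Ioc.mp hn).2).trans hN
  nlinarith

/-! ## §3 The leg-dressing term: a leg crosses at most five slices -/

/-- `klScale` is strictly antitone in the scale index (`e₀ > 0`). -/
theorem klbf_klScale_le_iff {e₀ : ℝ} (he : 0 < e₀) {a b : ℕ} : klScale e₀ a ≤ klScale e₀ b ↔ b ≤ a := by
  unfold klScale
  have h4a : (0 : ℝ) < 4 ^ a := by positivity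
  have h4b : (0 : ℝ) < 4 ^ b := by positivity
  constructor
  · intro h
    by_contra hba
    have hlt : (4 : ℝ) ^ a < 4 ^ b := pow_lt_pow_right₀ (by norm_num) (lt_of_not_ge hba)
    have hinv : 1 / (4 : ℝ) ^ b < 1 / (4 : ℝ) ^ a := one_div_lt_one_div_of_lt h4a hlt
    simp only [one_div] at hinv
    have := mul_lt_mul_of_pos_left hinv he
    linarith
  · intro hba
    exact mul_le_mul_of_nonneg_left (inv_anti₀ h4b (pow_le_pow_right₀ (by norm_num) hba)) he.le

/-- If a leg's energy `e` lies in the windows of two scales `n, n'` (`Λ_{n+2} ≤ e ≤ Λ_{n'-2}`), then `n' ≤ n + 4`. -/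
theorem klbf_legSlice_spread {e₀ e : ℝ} (he : 0 < e₀) {n n' : ℕ} (h₁ : klScale e₀ (n + 2) ≤ e)
    (h₂ : e ≤ klScale e₀ (n' - 2)) : n' ≤ n + 4 := by
  have h := (klbf_klScale_le_iff he).mp (h₁.trans h₂)
  omega

/-- **A leg crosses at most five slices**: the set of scales `n` with `Λ_{n+2} ≤ e ≤ Λ_{n-2}` inside any finite set has at most `5`
elements (`e₀ > 0`; `Λ_n = klScale e₀ n`, ℕ-subtraction in `n - 2`). -/
theorem klbf_card_legSlice_le {e₀ : ℝ} (he : 0 < e₀) (e : ℝ) (s : Finset ℕ) :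
    (s.filter fun n => klScale e₀ (n + 2) ≤ e ∧ e ≤ klScale e₀ (n - 2)).card ≤ 5 := by
  classical
  set T := s.filter fun n => klScale e₀ (n + 2) ≤ e ∧ e ≤ klScale e₀ (n - 2) with hT
  rcases T.eq_empty_or_nonempty with h0 | hne
  · rw [h0]; simp
  · set n₀ := T.min' hne with hn₀
    have hmem : n₀ ∈ T := T.min'_mem hne
    have hn₀' : klScale e₀ (n₀ + 2) ≤ e := ((mem_filter.mp hmem).2).1
    have hsub : T ⊆ Icc n₀ (n₀ + 4) := fun n hn =>
      mem_Icc.mpr ⟨T.min'_le n hn, klbf_legSlice_spread he hn₀' ((mem_filter.mp hn).2).2⟩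
    calc T.card ≤ (Icc n₀ (n₀ + 4)).card := card_le_card hsub
      _ = 5 := by rw [Nat.card_Icc]; omega

/-- The leg-dressing indicator summed over any finite set of scales is `≤ 5` per leg. -/
theorem klbf_sum_legSlice_indicator_le {e₀ : ℝ} (he : 0 < e₀) (e : ℝ) (s : Finset ℕ) :
    ∑ n ∈ s, (if klScale e₀ (n + 2) ≤ e ∧ e ≤ klScale e₀ (n - 2) then (1 : ℝ) else 0) ≤ 5 := by
  classical
  rw [← sum_filter, sum_const, nsmul_eq_mul, mul_one]
  exact_mod_cast klbf_card_legSlice_le he e s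

end Summit.HubbardSuperconductivity.HubbardSuperconductivity.Theorems.KLRegimeSplit

end
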